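import Mathlib
import Literature.Computability.Complexity.SymbolPrograms
import Literature.Computability.Complexity.BoolEncodings
import Literature.Computability.MetaComplexity.Magnification
import HarnessLib

/-!
# Table machines, and the time-insensitivity of the non-uniform streaming class `STREAM S T`

Solo seat `solo-PneNP-blind` (blind mode), audit lemma for the "uniform hardness magnification"
corridor towards `PneNP` (McKay–Murray–Williams, STOC 2019, Thm. 1.3: poly(s)-space,
poly(s)-update-time one-pass streaming lower bounds for `MCSP[s]` imply `P ≠ NP`).

1. **Table machines** (`TableMachine.exists_machine`, `exists_machine_of_bounded`): for every
   function `g : List Bool → List Bool` and every bound `m`, SOME Mathlib `TM2` machine outputs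
   `g x` on every input `x` of length `≤ m` within `2|x| + |g x| + 4` steps. The machine is a
   complete binary decision tree of depth `m` (a `pop`-trie in the structured stack programs of
   `SymbolPrograms.lean`), i.e. its number of labels is exponential in `m` — the model bounds
   time, not program size. [folklore: a finite function is computed by a finite automaton]

2. **Consequence for `STREAM`** (`hasUpdateTime_of_hasSpace`, `mem_STREAM_of_hasSpace`): in the
   tree's one-pass streaming model (`Magnification.lean`) the update-time clause
   `HasUpdateTime S T := ∀ N, ∃ M, …` lets the machine depend on the input length `N` with no
   bound on its size, so EVERY streaming algorithm with space `S` has update time `5 S + 10`: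
   `STREAM S T` coincides with "one-pass space `S`" as soon as `T ≥ 5 S + 10`. Hence a
   hypothesis of the form `L ∉ STREAM S T` with `T ≥ 5 S + 10` is a purely information-theoretic
   (one-way communication) statement; the uniform update-TIME bound that carries the whole
   content of the McKay–Murray–Williams hypothesis is not expressed by this class. (The companion
   file `SoloBlindSparseStreaming.lean` shows that `MCSP[s]` itself lies in `STREAM (poly s) (poly s)`.)

References: D. M. McKay, C. D. Murray, R. R. Williams, *Weak lower bounds on resource-bounded
compression imply strong separations of complexity classes*, STOC 2019, §2 (streaming model),
Thm. 1.3 [doi:10.1145/3313276.3316396]; M. Minsky, *Computation: finite and infinite machines*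
(1967), §11.1.
-/

namespace Summit.PneNP.PneNP.Theorems

open Literature.Computability.Complexity Literature.Computability.MetaComplexity

namespace SoloBlind

/-! ### Table machines: every length-bounded function in linear time, non-uniformly -/

namespace TableMachine

open ACom

/-- Two registers: input and output. -/
inductive R2
  | inp | out
  deriving DecidableEq, Fintype

/-- The store with `x` in the input register and `o` in the output register. -/
def st (x o : List Bool) : AStore Bool R2 := fun i => match i with | .inp => x | .out => o

/-- The input register of `st x o`. -/
@[simp] theorem st_inp (x o : List Bool) : st x o .inp = x := rfl
/-- The output register of `st x o`. -/
@[simp] theorem st_out (x o : List Bool) : st x o .out = o := rfl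

/-- Updating the input register. -/
@[simp] theorem update_st_inp (x o x' : List Bool) : Function.update (st x o) .inp x' = st x' o := by
  funext i; cases i <;> simp [st]

/-- Updating the output register. -/
@[simp] theorem update_st_out (x o o' : List Bool) : Function.update (st x o) .out o' = st x o' := by
  funext i; cases i <;> simp [st]

/-- The initial store of `SymbolPrograms` in terms of `st`. -/
theorem single_inp (x : List Bool) : AStore.single R2.inp x = st x [] := by
  funext i; cases i <;> simp [AStore.single, st]

/-- The final store of `SymbolPrograms` in terms of `st`. -/
theorem single_out (o : List Bool) : AStore.single R2.out o = st [] o := by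
  funext i; cases i <;> simp [AStore.single, st]

/-- Push the word `w` onto the output register, last symbol first, so that `w` ends up on top in
reading order: from `out = o` to `out = w ++ o`, at cost `|w|`. -/
def emit : List Bool → ACom Bool R2
  | [] => skip
  | b :: w => emit w ;; push .out b

/-- Effect and cost of `emit`: `out = o ↦ out = w ++ o` at cost `|w|`. [folklore] -/
theorem runs_emit : ∀ (w x o : List Bool), Runs (emit w) (st x o) (st x (w ++ o)) w.length
  | [], x, o => by simpa [emit] using Runs.skip (st x o)
  | b :: w, x, o => by
    have h1 := runs_emit w x o
    have h2 : Runs (push R2.out b) (st x (w ++ o)) (st x (b :: (w ++ o))) 1 := Runs.push' (by simp)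
    simpa [emit] using h1.seq h2

/-- Discard the content of the input register: cost `2 |x| + 1`. -/
def drain : ACom Bool R2 := loop .inp fun _ => skip

/-- Effect and cost of `drain`: the input register is emptied at cost `2 |x| + 1`. [folklore] -/
theorem runs_drain (x o : List Bool) : Runs drain (st x o) (st [] o) (2 * x.length + 1) := by
  have h := runs_loop_inv (k := R2.inp) (f := fun _ => (skip : ACom Bool R2))
    (fun _ rest => st rest o) (fun _ _ => True) 0
    (fun _ _ _ => rfl)
    (fun done a rest _ => ⟨trivial, by simpa using Runs.skip (st rest o)⟩)
    x [] trivial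
  exact h.of_eq rfl (by omega)

/-- The decision tree ("trie") of depth `m` for `g`: pop up to `m` input symbols, branching on
each, then (drain whatever is left and) emit the value of `g` on the word read. -/
def trie : (List Bool → List Bool) → ℕ → ACom Bool R2
  | g, 0 => drain ;; emit (g [])
  | g, m + 1 => pop .inp fun o => match o with
    | none => emit (g [])
    | some a => trie (fun w => g (a :: w)) m

/-- Semantics and cost of the trie: on input `x` it outputs `g (x.take m)` within
`2 |x| + 3 + |g (x.take m)|` steps. -/
theorem runs_trie : ∀ (m : ℕ) (g : List Bool → List Bool) (x : List Bool),
    Runs (trie g m) (st x []) (st [] (g (x.take m))) (2 * x.length + 3 + (g (x.take m)).length)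
  | 0, g, x => by
    have h1 := runs_drain x []
    have h2 := runs_emit (g []) [] []
    simp only [List.append_nil] at h2
    have h : Runs (trie g 0) (st x []) (st [] (g [])) (2 * x.length + 1 + (g []).length) :=
      h1.seq h2
    simp only [List.take_zero]
    exact h.mono (by omega)
  | m + 1, g, [] => by
    have h2 := runs_emit (g []) [] []
    simp only [List.append_nil] at h2
    have h : Runs (trie g (m + 1)) (st [] []) (st [] (g [])) ((g []).length + 2) :=
      Runs.pop_nil rfl h2
    simp only [List.take_nil, List.length_nil]
    exact h.mono (by omega)
  | m + 1, g, a :: x => by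
    have ih := runs_trie m (fun w => g (a :: w)) x
    have h : Runs (trie g (m + 1)) (st (a :: x) [])
        (st [] (g (a :: x.take m))) (2 * x.length + 3 + (g (a :: x.take m)).length + 2) :=
      Runs.pop_cons (k := R2.inp) (a := a) (w := x) rfl (by simpa using ih)
    simp only [List.take_succ_cons, List.length_cons]
    exact h.mono (by omega)

/-- **Table machines.** For every `g : List Bool → List Bool` and every `m`, some `TM2` machine
outputs `g (x.take m)` on every input `x` within `2 |x| + |g (x.take m)| + 4` steps.
[folklore] -/
theorem exists_machine (g : List Bool → List Bool) (m : ℕ) :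
    ∃ M : Turing.TM2ComputableAux Bool Bool, ∀ x : List Bool,
      M.OutputsWithin x (g (x.take m)) (2 * x.length + (g (x.take m)).length + 4) := by
  obtain ⟨M, hM⟩ := ACom.exists_computesInTime (trie g m) R2.inp R2.out
    (id : List Bool → List Bool) (id : List Bool → List Bool) (fun x => g (x.take m))
    (fun x => 2 * x.length + 3 + (g (x.take m)).length)
    (fun x => by simpa [single_inp, single_out] using runs_trie m g x)
  have hM' : ∀ x : List Bool,
      M.OutputsWithin x (g (x.take m)) (2 * x.length + 3 + (g (x.take m)).length + 1) :=
    fun x => hM x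
  exact ⟨M, fun x => (hM' x).mono (by omega)⟩

/-- **Every function on words of length `≤ m` is computed in linear time by some machine**
(of size exponential in `m`: the `TM2` model bounds time, not program size). [folklore] -/
theorem exists_machine_of_bounded (g : List Bool → List Bool) (m : ℕ) :
    ∃ M : Turing.TM2ComputableAux Bool Bool, ∀ x : List Bool, x.length ≤ m →
      M.OutputsWithin x (g x) (2 * x.length + (g x).length + 4) := by
  obtain ⟨M, hM⟩ := exists_machine g m
  refine ⟨M, fun x hx => ?_⟩
  have h := hM x
  rwa [List.take_of_length_le hx] at h

end TableMachine

/-! ### The update-time clause of `STREAM` is implied by the space clause -/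

/-- **Space implies update time, non-uniformly.** In the tree's streaming model, any algorithm
with space bound `S` has update time `T` for every `T ≥ 5 S + 10`: for each input length `N`
take the table machine of the finite map `⟨st, b⟩ ↦ update N st b` on states of length
`≤ S N` (pairs `boolPair st [b]` have length `2 |st| + 3`). -/
theorem hasUpdateTime_of_hasSpace (A : StreamingAlgorithm) {S T : ℕ → ℕ} (hS : A.HasSpace S)
    (hT : ∀ N, 5 * S N + 10 ≤ T N) : A.HasUpdateTime S T := by
  intro N
  obtain ⟨M, hM⟩ := TableMachine.exists_machine_of_bounded
    (fun w => A.update N (boolUnpair w).1 ((boolUnpair w).2.headD false)) (2 * S N + 3)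
  refine ⟨M, fun st b hst => ?_⟩
  have hlen : (boolPair st [b]).length ≤ 2 * S N + 3 := by
    simp only [length_boolPair, List.length_cons, List.length_nil]; omega
  have h := hM (boolPair st [b]) hlen
  simp only [boolUnpair_boolPair, List.headD_cons] at h
  refine h.mono ?_
  have hout := (hS N).2 st b hst
  simp only [length_boolPair, List.length_cons, List.length_nil]
  have := hT N
  omega

/-- **`STREAM S T` is the one-pass space class for `T ≥ 5 S + 10`.** A language decided by a
one-pass streaming algorithm with space `S` — no constraint whatsoever on the update maps — lies
in `STREAM S T`. -/
theorem mem_STREAM_of_hasSpace {L : Language Bool} {S T : ℕ → ℕ}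
    (h : ∃ A : StreamingAlgorithm, A.HasSpace S ∧ A.Decides L) (hT : ∀ N, 5 * S N + 10 ≤ T N) :
    L ∈ STREAM S T := by
  obtain ⟨A, hS, hD⟩ := h
  exact ⟨A, hS, hasUpdateTime_of_hasSpace A hS hT, hD⟩

/-- The same with the canonical time function `5 S + 10`. -/
theorem STREAM_space_only (S : ℕ → ℕ) :
    {L : Language Bool | ∃ A : StreamingAlgorithm, A.HasSpace S ∧ A.Decides L} ⊆
      STREAM S (fun N => 5 * S N + 10) :=
  fun _ h => mem_STREAM_of_hasSpace h fun _ => le_rfl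

end SoloBlind

end Summit.PneNP.PneNP.Theorems
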